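import Literature.NumberTheory.Automorphic.Liu2021.AppendixC.DefC1toC3                  -- ★ `HermSpace` (`sig`, `IsNegAt`, `Gfin`, `gram`), `conj`, `restr`, `IsQuasiProjectiveOver`
import Literature.NumberTheory.ComplexMultiplication.CMTypeDistinguishedElementReflexField -- ★ (3.1) `Aut(ℂ/E) = Stab(Φ) ∩ Stab(φ₀)`, `apply_mem_traceField_sup_fieldRange`; brings ★ `traceField`
import Literature.AlgebraicGeometry.AbelianSchemes.AbelianSchemeOverRingAction            -- ★ `AbelianSchemeOver.RingAction (𝓞 F)` («`ι₀ : O_F → End(A₀)`»)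
import Literature.AlgebraicGeometry.AbelianSchemes.AbelianSchemePolarizationBaseChange     -- ★ `DualPair`, `Polarization` (+ `baseChange`)
import Literature.AlgebraicGeometry.AbelianSchemes.AbelianSchemeFixedPowBaseChange         -- ★ `RingAction.baseChange`
import Literature.AlgebraicGeometry.Motives.AlgPoints                                      -- ★ `AlgPoints X Ω` (the `Ω`-points of a `k`-scheme)
import HarnessLib

/-!
# [RapoportSmithlingZhang2020Diagonal] §3 «The Shimura varieties» (§3.1 «The Shimura data», §3.2 «The moduli problem over `E`»)
# — the rows cited by the HC_CM lines, STATED AS PRINTED (named-fact carpet; NO proofs, NO `sorry`, NO instance, NO notation)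

M. Rapoport, B. Smithling, W. Zhang, *Arithmetic diagonal cycles on unitary Shimura varieties*, Compos. Math. **156** (2020)
1745–1824 = arXiv:1710.06962 **v6** (bib key `RapoportSmithlingZhang2020Diagonal`).  PAGE PINS «p. N» = arXiv v6 PDF page, read on
the cell's per-page text of record `F0/P6/lit1/RSZ2020-v6-pages.txt` (the house form of the 300-odd existing tree tags; the Compositio
offset is not held and no journal page is claimed).  NUMBERING is per section (`\numberwithin`): §3.1 = Remark 3.1 (p. 9), Remark 3.2
(pp. 9–10), Remark 3.3 (p. 10), displays (3.1)–(3.5); §3.2 = displays (3.6)–(3.8) (p. 11), Lemma 3.4 + (3.9)–(3.10) + Remark 3.5 (p. 12),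
(3.11)–(3.14) + Remark 3.6 + Proposition 3.7 (p. 13), (3.15)–(3.16) (p. 14), (3.17) + Remark 3.8 (p. 15).  (The held TeX extraction
`paper:arxiv-1710.06962` is an EARLY arXiv version with GLOBAL counters — «Remark 5», «Proposition 9» — and is NOT the numbering used here.)

Cell `hodgecm-mathlib`, GO-500 carpet squad TL (seat TL-t10), file 1 of the t10 deal (TL-plan 2026-09-02: «RSZ2020 §3 — the rows the P6
lines cite: §3.1 set-up (signatures), Rem. 3.1–3.3, §3.2 incl. (3.8), Lemma 3.4, Rem. 3.5, Rem. 3.6 (i) (3.14) + (ii), Prop. 3.7»).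
HONEST LABEL: HC_CM is proved only modulo the 7 printed citations (2 remaining: hLiu418 = stmt-HodgeConjecture-24832, h413 =
stmt-HodgeConjecture-24833) until rung 0 closes; this file asserts NOTHING — every numbered item is a `def … : Prop` that a consumer takes as a
hypothesis `(h : Item D)` for ITS OWN datum `D` (never `∀ D`), and nothing printed is claimed to hold.

## How the printed objects are typed (paper order).  REAL = genuine Mathlib ∕ tree object; ⟨CARRIER⟩ = posited datum standing for a printed
## object Lean cannot construct (same discipline as ★ `Liu2021.Thm418Data`, ★ `Liu2021.AppendixC.HermSpace.ShimuraSystem`); READINGS R1–R8.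

* «`F` a CM field over `ℚ` and `F₀` its totally real subfield of index 2» (§3 p. 8; Notation p. 5) = the binders
  `[Field F₀] [NumberField F₀] [IsTotallyReal F₀] [Field F] [NumberField F] [Algebra F₀ F] [IsTotallyComplex F] [Algebra.IsQuadraticExtension F₀ F]`
  (READING R1 = the presentation of the same pair of fields used by ★ `Liu2021.Thm418Data` ∕ ★ `Liu2021.AppendixC`, there written `F ⊆ E`);
  «`a ↦ ā` the nontrivial automorphism of `F/F₀`» = ★ `Liu2021.AppendixC.conj F₀ F`.  REAL.
* «a presentation `F = F₀(√Δ)` for some totally negative `Δ ∈ F₀`» and the CM type **(1.3)** `Φ := {φ : F → ℂ ∣ φ(√Δ) ∈ ℝ_{>0} √−1}` (p. 5),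
  «the induced CM type for `F`» (p. 8): fields `Δ`, `sqrtΔ`, `Φ : CMType F` (★ `Motives.CMType`) of `ShimuraDatum` with the printed relations as
  hypotheses (`sqrtΔ_sq`, `Δ_totallyNegative`, `mem_Φ_iff`).  REAL.
* «`W` a non-degenerate `F/F₀`-hermitian space of dimension `n ≥ 2`», «hermitian forms linear in the first variable» (§2.1 p. 7, p. 6) = ★
  `Liu2021.AppendixC.HermSpace F₀ F` (REAL; its `n`, `form`, `sig`); «a non-isotropic vector `u ∈ W`, the special vector» (p. 7); §3.1 p. 8:
  «for a distinguished element `φ₀ ∈ Φ`, the signature of `W_{φ₀}` is `(1, n−1)`, and for all other `φ ∈ Φ` the signature of `W_φ` is `(0, n)`.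
  We also assume that the special vector `u` is totally negative, i.e. that `(u,u)_φ < 0` for all `φ`» — `W_φ := W ⊗_{F,φ} ℂ` (p. 6); its
  signature is ★ `HermSpace.sig W (φ|_{F₀})` (READING R2: the signature of `W ⊗_{F₀,φ|F₀} ℝ`, independent of the choice of `φ` above `φ|_{F₀}`;
  «we often identify `Φ` with the archimedean places of `F₀`», p. 6), `φ|_{F₀}` = ★ `restr F₀ F φ`; `(u,u)_φ < 0` = ★ `HermSpace.IsNegAt`.  REAL.
* `G := U(W)` (p. 7), `G(𝔸_{F₀,f})` = ★ `HermSpace.Gfin W` (REAL topological group), `G(F₀) = U(W)(F₀)` = ★ `HermSpace.rationalPoints`.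
  `Z^ℚ`, `G^ℚ`, `G̃ = Z^ℚ ×_{𝔾_m} G^ℚ` (p. 7) and (2.1) `G̃ ≅ Z^ℚ × Res_{F₀/ℚ} G`: by **(3.6)–(3.7)** (p. 11) «We will only consider open compact
  subgroups `K_G̃ ⊂ G̃(𝔸_f)` which, with respect to the product decomposition (2.1), are of the form `K_G̃ = K_{Z^ℚ} × K_G`, where
  `K_G ⊂ G(𝔸_{F₀,f})` is an open compact subgroup and where `K_{Z^ℚ} ⊂ Z^ℚ(𝔸_f)` is the unique maximal compact subgroup
  `K_{Z^ℚ} := Z^ℚ(ℤ̂) = {z ∈ (O_F ⊗ ℤ̂)^× ∣ Nm_{F/F₀}(z) ∈ ℤ̂^×}`» ⇒ READING R3: every Shimura variety ∕ moduli space below is indexed by the REAL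
  subgroup `K_G ≤ G(𝔸_{F₀,f})` alone, `K_{Z^ℚ}` being the fixed group (3.7); the §3.1 generality «`K_G̃` varies through the open compact
  subgroups of `G̃(𝔸_f)`» is recorded, not typed.  -- TODO(general form): arbitrary `K_G̃ ≤ G̃(𝔸_f)` needs `Z^ℚ(𝔸_f)` (norm maps of finite adèles).
* (3.1) «common reflex field `E ⊂ ℂ` characterized by `Aut(ℂ/E) = {σ ∈ Aut(ℂ) ∣ σ ∘ Φ = Φ and σ ∘ φ₀ = φ₀}`» and **Remark 3.1** (p. 9) «In general,
  `E` is the join of `F` (embedded in `ℚ̄` via `φ₀`) and the reflex field `E_Φ` of `Φ` (the latter is the fixed field in `ℂ` of the group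
  `{σ ∈ Aut(ℂ) ∣ σ ∘ Φ = Φ}`). In particular, `φ₀` always embeds `F` into `E`, but `E` may be larger.» = the REAL `def reflexField` :=
  `E_Φ · φ₀(F)` (★ `ComplexMultiplication.traceField Φ ⊔ φ₀(F)`).  CITED BY NAME, NOT RESTATED (already theorems of the tree): (3.1) itself = ★
  `ComplexMultiplication.CMTypeDistinguishedElementReflexField` (`eq_traceField_sup_fieldRange_iff_forall`, `forall_mem_traceField_sup_fieldRange_iff`:
  `Aut(ℂ/E_Φ·φ₀(F)) = Stab(Φ) ∩ Stab(φ₀)`); «`φ₀` embeds `F` into `E`» = ★ `apply_mem_traceField_sup_fieldRange`; Remark 3.2 (i) «`E_Φ ⊂ E`» = ★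
  `traceField_le_traceField_sup_fieldRange`; the reflex field of the signature `r` vs. `E` = ★ `KottwitzSignatureReflexField*`, ★
  `KudlaRapoportSignatureReflexField`.  Remark 3.1, first sentence (Harris–Taylor case `F = K F₀`, `φ₀ : F ≅ E`) is typed (`Rem31_harrisTaylor`).
* Canonical models `Sh_{K_G̃}(G̃, {h_G̃})` over `E` (p. 9), `Sh_{K_{Z^ℚ}}(Z^ℚ, {h_{Z^ℚ}})` over its reflex field `E_Φ` (Remark 3.2 (i) p. 10),
  `Sh_{K_G}(Res_{F₀/ℚ} G, {h_G})` «over its reflex field, which is `F`, embedded into `ℂ` via `φ₀`» (Remark 3.2 (iii) p. 10) = ⟨CARRIER⟩ fields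
  `ShG`, `ShZ`, `ShResG` of `Sec3Data` (schemes over the REAL fields `E`, `E_Φ`, `F`; READING R4 as ★ `HermSpace.ShimuraSystem`: «over `φ₀(F)`» is
  read over `F` along `φ₀ : F ≅ φ₀(F)`), with the morphisms (3.3) `Sh(G̃) → Sh(Z^ℚ)` and (3.5) `Sh(G̃) → Sh(Res G)` as ⟨CARRIER⟩ morphisms of
  schemes commuting with the REAL base maps `Spec E → Spec E_Φ`, `Spec E → Spec F` (the latter = `φ₀`, REAL `phi0ToReflexFieldOf` by ★ `apply_mem_traceField_sup_fieldRange`).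
  The Shimura DATA `h_{G^ℚ}`, `h_{Z^ℚ}`, `h_G̃` (pp. 8–9) have no tree vocabulary and are recorded only; Remark 3.3's cocharacter
  «`h_{G,φ₀} : z ↦ diag(z/z̄, 1, …, 1)`» and «`𝒟_{φ₀}` = the open subset of positive-definite lines in `ℙ(W_{φ₀})(ℂ)`» ARE typed (REAL `cocharPhi0`,
  `posCone`); its presentation «`Sh_{K_G̃}(G̃, {h_G̃})(ℂ) = G̃(ℚ)∖[𝒟_{φ₀} × G̃(𝔸_f)/K_G̃]`» is RECORDED, not typed (the diagonal embedding
  `G(F₀) → G(𝔸_{F₀,f})` of the tree's unitary-group carrier is not exposed as a map to state it on).  NOT TYPED (recorded): `H = U(W^♭)`, `H̃`, `H̃G`, the embeddings (2.2), the injections (3.2), the fibre-product identity of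
  Remark 3.2 (i), Remark 3.2 (ii), the GGP data of Remark 3.2 (iii) («not of PEL type»), (3.15)–(3.17) — none is a row the HC_CM lines cite.
* §3.2 objects.  «`S` a locally noetherian `O_E`-scheme» = `S : Scheme` with `[IsLocallyNoetherian S]` and a REAL structure map
  `f : S ⟶ Spec O_E`, `O_E = 𝓞 E` (Mathlib ring of integers of the REAL number field `E ⊂ ℂ`).  «`A₀` an abelian variety [scheme] over `S`» = ★
  `AbelianSchemes.AbelianSchemeOver S`; «an `O_F`-action `ι₀ : O_F → End(A₀)`» = ★ `AbelianSchemeOver.RingAction (𝓞 F) A₀`; «a (principal)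
  polarization `λ₀`» = ★ `A₀.Polarization D₀` for a ★ `DualPair` `D₀` (principal = `IsIso λ₀.lam`, REAL).  The three printed CLAUSES that the
  tree cannot yet evaluate on these REAL objects over a general base are the ⟨CARRIER⟩ PREDICATES `M0Clauses` (field `clauses` of `Sec3Data`), each quoting its print:
  `IsKottwitz f A ι r` = «`(A, ι)` satisfies the Kottwitz condition of signature `r`, i.e. `char(ι(a) ∣ Lie A) = ∏_{φ ∈ Hom(F,ℂ)} (T − φ(a))^{r_φ}`
  for all `a ∈ O_F`» ((3.8), (3.11), Remark 3.6 (i); the tree evaluates it over LOCAL affine bases, ★ `AbelianScheme.lieCharpoly`, and along field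
  points, ★ `RingActionLieSignatureSpecialPoint` — READING R5: one predicate, parametrised by the REAL signature function `r`, so that (3.8) is
  `r = sig₀` («signature `((0,1)_{φ∈Φ})`», `char = ∏_{φ∈Φ}(T − φ̄(a))`) and (3.11) is `r =` the function (3.14));
  `RosatiIsConj A D λ ι` = «whose Rosati involution induces on `O_F`, via `ι`, the nontrivial Galois automorphism of `F/F₀`»;
  `KerEqTorsion A D λ ι 𝔞` = «`ker λ₀ = A₀[𝔞]`» (the variant `M₀^𝔞`, p. 11); `PolPullback e λ λ'` = «under which `λ₀'` pulls back to `λ₀`» (morphisms).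
* `M₀`, `M₀^𝔞` (p. 11): the objects of `M₀^𝔞(S)` = the REAL structure `M0Obj C 𝔞 f` (`C` the clause predicates); `M₀` itself is the case `𝔞 = O_{F₀} = ⊤`
  (READING R6: print's «except that we replace the condition that `λ₀` is principal by the condition that `ker λ₀ = A₀[𝔞]`», and `ker λ₀ = A₀[O_{F₀}] = 0`
  iff `λ₀` is principal — the AXIOM `kerEqTorsion_top` of `Sec3Data`, with REAL right-hand side `IsIso λ₀`); morphisms = `M0Obj.Iso` (REAL `O_F`-linear
  isomorphism of `S`-group schemes + ⟨CARRIER⟩ `PolPullback`).  AXIOMS OF THE POSITED OBJECTS (`kerEqTorsion_top`, `objM0_label`, `coarsePt_bijective`)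
  are `Prop` FIELDS of `Sec3Data`, not cited results (no D-0026 debt); the ten printed rows are the `def … : Prop` items.  «`M₀^𝔞` is a Deligne–Mumford stack, finite and étale over `Spec O_E`, cf. [Howard2012, Prop. 3.1.2]» and «`M₀` is
  defined over `O_{E_Φ}`» (Remark 3.5 (iv)) are printed CLAIMS about the stack — RECORDED, NOT TYPED (no DM-stack vocabulary in Mathlib ∕ tree).
* `L_Φ^𝔞` (p. 11) = the REAL structure `HermLattice D 𝔞`: «pairs `(Λ₀, ⟨,⟩₀)` consisting of a locally free `O_F`-module `Λ₀` of rank one equipped with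
  a non-degenerate alternating form `⟨,⟩₀ : Λ₀ × Λ₀ → ℤ` such that `⟨ax, y⟩₀ = ⟨x, āy⟩₀` for all `x, y ∈ Λ₀`, `a ∈ O_F`, such that `x ↦ ⟨√Δ x, x⟩₀` is
  a negative-definite quadratic form on `Λ₀`, and such that the dual lattice `Λ₀^∨` of `Λ₀` inside `Λ₀ ⊗ ℚ` equals `𝔞^{-1}Λ₀`» — READING R7: `Λ₀`
  is realised inside `Λ₀ ⊗_ℤ ℚ ≅ F` as a non-zero finitely generated `O_F`-submodule of `F` (every locally free rank-one `O_F`-module is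
  isomorphic to one, and `L_Φ^𝔞` is a set of ISOMORPHISM CLASSES), the form being a `ℚ`-bilinear form on `F`, `ℤ`-valued on `Λ₀`.  The relation
  `∼` (p. 12) «`Λ₀ ∼ Λ₀'` if `Λ₀ ⊗ ℤ̂` and `Λ₀' ⊗ ℤ̂` are `Ô_F`-linearly similar up to a factor in `ℤ̂^×`, and if `Λ₀ ⊗ ℚ` and `Λ₀' ⊗ ℚ` are
  `F`-linearly similar up to a factor in `ℚ^×`» = REAL rational half `HermLattice.RatSimilar` ∧ ⟨CARRIER⟩ adelic half `Sec3Data.HatSimilar`;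
  `L_Φ^𝔞/∼` = `Quot` by it.  «Then `L_Φ^𝔞` is a finite set» (p. 11, footnote 7) and «`L_Φ^𝔞` is in bijection with the isomorphism classes of objects
  in `M₀^𝔞(ℂ)`» via «`H₁(A₀(ℂ), ℤ)`, endowed with its Riemann form» (p. 11) are typed (`LPhi_finite`, `LPhi_bijective`) over the ⟨CARRIER⟩ map
  `riemannLattice` (singular homology with Riemann form of a REAL abelian scheme over `Spec ℂ` is not constructible in the tree today) — PARTIAL: defined
  on OBJECTS of `M₀^𝔟(ℂ)` for `𝔟 ≠ 0` only (the type `HermLattice … ⊥` is empty, and `L_Φ^𝔟` may be empty exactly when `M₀^𝔟(ℂ)` is, p. 11 «it may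
  happen that `M₀` is empty»), so that the datum has its intended model.
* **Lemma 3.4** (p. 12) «The stack `M₀^𝔞` admits a decomposition into open and closed substacks `M₀^𝔞 = ∐_{ξ ∈ L_Φ^𝔞/∼} M₀^{𝔞,ξ}` (3.9) induced by
  sending an object `(A₀, ι₀, λ₀)` in `M₀^𝔞(ℂ)` to the `∼`-class of `H₁(A₀(ℂ), ℤ)` endowed with its Riemann form» (generic fibre: (3.10)) = `Lemma34`:
  the PARTIAL ⟨CARRIER⟩ labelling `label` of OBJECTS of `M₀^𝔟` (`𝔟 ≠ 0`) over CONNECTED (hence non-empty) `O_E`-schemes by `L_Φ^𝔟/∼` is (a) invariant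
  under isomorphisms, (b) for an object over a connected base equal to the label of every object over a field-valued point whose components are the REAL
  ★ `baseChange`s of its components — READING R8 = «open and closed substacks»: a connected `S → M₀^𝔞` lands in one summand —, (c) at `S = Spec ℂ`
  equal to the class of `riemannLattice` («induced by»).  Sequel (p. 12) «for fixed `ξ`, the complex
  fiber `M₀^{𝔞,ξ} ⊗_{O_E} ℂ` is canonically isomorphic to `Sh_{K_{Z^ℚ}}(Z^ℚ)`» = `Lemma34_complexFibre`, ON COMPLEX POINTS (isomorphism classes of
  objects over `Spec ℂ` with label `ξ` ↔ `ℂ`-points of the carrier `ShZ`).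
* **Remark 3.5** (p. 12): (i) «Given finitely many prime numbers `p₁, …, p_r`, there always exists an ideal `𝔞` relatively prime to `p₁, …, p_r` such
  that `M₀^𝔞` is non-empty» = `Rem35_i`; (ii) «If `F/F₀` is ramified at some finite place, then `M₀^𝔞` is non-empty for any `𝔞`» = `Rem35_ii`
  («non-empty» read as: has an object over `Spec ℂ` — equivalent for a stack finite étale over `O_E`, p. 11); (iii) «When `F₀ = ℚ`, the set `L_Φ^𝔞/∼`
  is a singleton» = `Rem35_iii`; (iv) (decomposition holds over `O_{E_Φ}`) and (v) (recipe for the label of a point in characteristic `p` via the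
  canonical lift) are RECORDED (INDEX), not typed.  (iii) is typed AS PRINTED: non-empty with one class.
* `M_{K_G̃}(G̃)` (pp. 12–13): «In the following, we fix an ideal `𝔞` such that `M₀^𝔞` is non-empty … We also fix `ξ ∈ L_Φ^𝔞/∼`» = fields `𝔞`, `ξ`.
  The objects over a locally noetherian `E`-scheme `S` are «collections `(A₀, ι₀, λ₀, A, ι, λ, η̄)`» with `(A₀, ι₀, λ₀) ∈ M₀^{𝔞,ξ}(S)`, «`A` an abelian
  scheme over `S` with an `F`-action `ι : F → End⁰(A)` satisfying the Kottwitz condition (3.11) of signature `((1, n−1)_{φ₀}, (0, n)_{φ ∈ Φ∖{φ₀}})`»,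
  «`λ` a polarization whose Rosati involution induces the nontrivial Galois automorphism of `F/F₀`», «`η̄` a `K_G̃`-level structure … a `K_G`-orbit of
  `𝔸_{F,f}`-linear isometries `η : V̂(A₀, A) ≃ −W ⊗_F 𝔸_{F,f}` (3.12)», `V̂(A₀, A) := Hom_F(V̂(A₀), V̂(A))` with the hermitian form (3.13)
  `h_A(x, y) := λ₀^{-1} ∘ y^∨ ∘ λ ∘ x ∈ End_{𝔸_{F,f}}(V̂(A₀)) = 𝔸_{F,f}`; morphisms = an isomorphism in `M₀^{𝔞,ξ}(S)` and «an `F`-linear quasi-isogeny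
  `μ : A → A'` pulling `λ'` back to `λ` and `η̄'` back to `η̄`».  Actions up to isogeny (`End⁰`), rational Tate modules of abelian schemes as
  `𝔸_{F,f}`-sheaves and quasi-isogenies have no tree vocabulary ⇒ the objects and their isomorphism relation are the ⟨CARRIER⟩ fields `Obj`, `ObjIso`,
  with REAL projections `objA` (the abelian scheme `A`) and `objM0` (the component `(A₀, ι₀, λ₀)`, a REAL `M0Obj` over `S → Spec E → Spec O_E`,
  its printed clauses being the fields of `M0Obj`, its label `ξ` the axiom `objM0_label`).  (3.11) for `objA` is recorded in the docstring of `Obj` (its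
  `F → End⁰` action is part of the carrier).
* **Remark 3.6** (p. 13): (i) the function **(3.14)** `r : Hom(F, ℂ) → {0, 1, n−1, n}`, `r_φ := 1 (φ = φ₀); 0 (φ ∈ Φ ∖ {φ₀}); n − r_φ̄ (φ ∉ Φ)` = REAL
  `def signatureFn`; «Then the Kottwitz condition (3.11) is `char(ι(a) ∣ Lie A) = ∏_{φ ∈ Hom(F,ℂ)} (T − φ(a))^{r_φ}` for all `a ∈ O_F`» is READING R5
  itself (INDEX); (ii) (the sign `−W` in (3.12) comes from the signature conventions; «If one took the opposite signatures for `W` and in the two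
  Kottwitz conditions, then no sign would be needed») is RECORDED (INDEX) — prose about conventions, nothing to type.
* **Proposition 3.7** (p. 13) «`M_{K_G̃}(G̃)` is a Deligne–Mumford stack smooth of relative dimension `n − 1` over `Spec E`. The coarse moduli scheme
  of `M_{K_G̃}(G̃)` is a quasi-projective scheme over `Spec E`, naturally isomorphic to the canonical model of `Sh_{K_G̃}(G̃, {h_G̃})`. For `K_G̃`
  sufficiently small, the forgetful morphism `M_{K_G̃}(G̃) → M₀^{𝔞,ξ}` is relatively representable.» = `Prop37` over the ⟨CARRIER⟩ coarse moduli
  scheme `coarse K` (a scheme over the REAL `E`, tied to `Obj` by the ⟨CARRIER⟩ classifying map `coarsePt` on geometric points, bijective on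
  isomorphism classes by the axiom `coarsePt_bijective` — the defining property of a coarse space on points): TYPED = sentence 2 (`IsQuasiProjectiveOver (coarse K)`, ★ Liu's predicate,
  and `coarse K ≅ ShG K` over `E`); sentences 1 and 3 (smoothness of the STACK, relative representability) are RECORDED, NOT TYPED (no stacks).
* **Remark 3.8** (p. 15) «For `F₀ ≠ ℚ`, the Shimura varieties above are compact.» = `Rem38` (`IsProper` of the carriers `ShG K` over `E`); its
  second half (for `F₀ = ℚ`, `M_{K_{H̃G}}(H̃G)` may be non-compact, automatically for `n ≥ 3`; toroidal compactification [Harris1989]) is recorded.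

## References
* [RapoportSmithlingZhang2020Diagonal] M. Rapoport, B. Smithling, W. Zhang, *Arithmetic diagonal cycles on unitary Shimura varieties*, Compos.
  Math. 156 (2020) 1745–1824, arXiv:1710.06962v6 — Notation p. 5 (1.3), p. 6; §2.1 p. 7; §3.1 pp. 8–10 (Rem. 3.1–3.3, (3.1)–(3.5)); §3.2
  pp. 11–15 ((3.6)–(3.17), Lemma 3.4, Rem. 3.5, Rem. 3.6, Prop. 3.7, Rem. 3.8).
* [Howard2012] B. Howard, *Complex multiplication cycles and Kudla–Rapoport divisors*, Ann. of Math. 176 (2012) — Prop. 3.1.2, Def. 3.1.1,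
  Th. 2.2.1 (RSZ's [20], for `M₀`, `M₀^𝔞`).
* [Kottwitz1992] R. E. Kottwitz, *Points on some Shimura varieties over finite fields*, JAMS 5 (1992) — §5 p. 390 (determinant condition).
* [Liu2021] Y. Liu, *Fourier–Jacobi cycles and arithmetic relative trace formula*, Camb. J. Math. 9 (2021) — App. C (the tree's `HermSpace` carrier).
-/

noncomputable section

open NumberField CategoryTheory AlgebraicGeometry
open scoped Matrix ComplexOrder Classical
open Literature.AlgebraicGeometry.Motives (CMType SchemeOver AlgPoints)
open Literature.AlgebraicGeometry.AbelianSchemes (AbelianSchemeOver)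
open Literature.NumberTheory.ComplexMultiplication (traceField)
open Literature.NumberTheory.Automorphic.Liu2021.AppendixC (HermSpace conj restr IsQuasiProjectiveOver)

namespace Literature.AlgebraicGeometry.ShimuraVarieties.RapoportSmithlingZhang2020.Sec3IntegralModels

universe u

variable (F₀ F : Type) [Field F₀] [NumberField F₀] [IsTotallyReal F₀] [Field F] [NumberField F] [Algebra F₀ F]
  [IsTotallyComplex F] [Algebra.IsQuadraticExtension F₀ F]

/-! ## §3 preamble and §3.1 «The Shimura data» (pp. 5–8): the REAL linear-algebraic datum -/

/-- **The standing data of [RSZ2020] §3.1** (with Notation p. 5 and §2.1 p. 7), in paper order, all REAL: the presentation `F = F₀(√Δ)`,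
the CM type `Φ` of (1.3), the hermitian space `W` of dimension `n ≥ 2` (★ `Liu2021.AppendixC.HermSpace`), the distinguished `φ₀ ∈ Φ` with the
signature hypotheses of p. 8, and the totally negative special vector `u`.  Nothing is asserted by this structure (its `Prop` fields are the
printed standing hypotheses). [cite: RapoportSmithlingZhang2020Diagonal, §3.1 p. 8; Notation (1.3) p. 5; §2.1 p. 7] -/
structure ShimuraDatum : Type 1 where
  /-- «some totally negative element `Δ ∈ F₀`» (p. 5). -/
  Δ : F₀
  /-- «totally negative» (p. 5): `τ(Δ) < 0` at every real place `τ` of `F₀`. -/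
  Δ_totallyNegative : ∀ τ : F₀ →+* ℝ, τ Δ < 0
  /-- «`√Δ ∈ F^×`», «a presentation `F = F₀(√Δ)`» (pp. 5, 8). -/
  sqrtΔ : F
  /-- `(√Δ)² = Δ` (p. 5). -/
  sqrtΔ_sq : sqrtΔ ^ 2 = algebraMap F₀ F Δ
  /-- «the CM type for `F` determined by `√Δ`» (1.3) (p. 5), «the induced CM type for `F`» (p. 8): ★ `Motives.CMType F`. -/
  Φ : CMType F
  /-- **(1.3)** «`Φ := {φ : F → ℂ ∣ φ(√Δ) ∈ ℝ_{>0} √−1}`» (p. 5). -/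
  mem_Φ_iff : ∀ φ : F →+* ℂ, φ ∈ Φ.1 ↔ ∃ t : ℝ, 0 < t ∧ φ sqrtΔ = (t : ℂ) * Complex.I
  /-- «`W` a non-degenerate `F/F₀`-hermitian space of dimension `n ≥ 2`» (§2.1 p. 7): ★ `HermSpace F₀ F` (form `F`-linear in the first
  variable, p. 6), `n = W.n`. -/
  W : HermSpace F₀ F
  /-- «of dimension `n ≥ 2`» (p. 7). -/
  two_le_n : 2 ≤ W.n
  /-- «a distinguished element `φ₀ ∈ Φ`» (p. 8). -/
  φ₀ : F →+* ℂ
  /-- `φ₀ ∈ Φ` (p. 8). -/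
  φ₀_mem : φ₀ ∈ Φ.1
  /-- «the signature of `W_{φ₀}` is `(1, n−1)`» (p. 8; READING R2). -/
  sig_φ₀ : W.sig (restr F₀ F φ₀) = (1, W.n - 1)
  /-- «for all other `φ ∈ Φ` the signature of `W_φ` is `(0, n)`» (p. 8; READING R2). -/
  sig_of_ne : ∀ φ : F →+* ℂ, φ ∈ Φ.1 → φ ≠ φ₀ → W.sig (restr F₀ F φ) = (0, W.n)
  /-- «a non-isotropic vector `u ∈ W`, which we call the special vector» (§2.1 p. 7). -/
  u : W.V
  /-- «non-isotropic» (p. 7): `(u, u) ≠ 0`. -/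
  form_u_ne_zero : W.form u u ≠ 0
  /-- «the special vector `u` is totally negative, i.e. `(u,u)_φ < 0` for all `φ`» (p. 8) — at every `φ ∈ Φ` ≃ archimedean place of `F₀` (p. 6),
  ★ `HermSpace.IsNegAt`. -/
  u_totallyNegative : ∀ φ : F →+* ℂ, φ ∈ Φ.1 → W.IsNegAt (restr F₀ F φ) u

section ReflexField

variable {F₀ F}

/-- **The reflex field `E ⊂ ℂ`** of (3.1), in the form printed in **Remark 3.1** (p. 9): «`E` is the join of `F` (embedded in `ℚ̄` via `φ₀`) and the
reflex field `E_Φ` of `Φ`» — `E_Φ` = ★ `ComplexMultiplication.traceField Φ` (Shimura's `ℚ(tr_Φ)`, the fixed field of `Stab(Φ)` by ★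
`ComplexReflexFieldStabilizer`), `φ₀(F)` = the field range of `φ₀`.  That this `E` satisfies (3.1) «`Aut(ℂ/E) = {σ ∈ Aut(ℂ) ∣ σ ∘ Φ = Φ and
σ ∘ φ₀ = φ₀}`» is the tree's ★ `CMTypeDistinguishedElementReflexField.eq_traceField_sup_fieldRange_iff_forall` (cited, not restated).
[cite: RapoportSmithlingZhang2020Diagonal, §3.1 (3.1) and Remark 3.1 p. 9] -/
def reflexFieldOf (Φ : CMType F) (φ₀ : F →+* ℂ) : IntermediateField ℚ ℂ :=
  traceField Φ ⊔ φ₀.toRatAlgHom.fieldRange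

/-- `φ₀` as a ring homomorphism `F → E` («`φ₀` always embeds `F` into `E`», Remark 3.1 p. 9; the membership is the tree's ★
`apply_mem_traceField_sup_fieldRange`).  Used for the base `Spec E → Spec F` of Remark 3.2 (iii).
[cite: RapoportSmithlingZhang2020Diagonal, Remark 3.1 p. 9] -/
def phi0ToReflexFieldOf (Φ : CMType F) (φ₀ : F →+* ℂ) : F →+* reflexFieldOf Φ φ₀ :=
  φ₀.codRestrict (reflexFieldOf Φ φ₀)
    (Literature.NumberTheory.ComplexMultiplication.apply_mem_traceField_sup_fieldRange Φ φ₀)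

/-- **The signature function of (3.8)**, «Kottwitz condition of signature `((0, 1)_{φ ∈ Φ})`, i.e. `char(ι₀(a) ∣ Lie A₀) = ∏_{φ ∈ Φ} (T − φ̄(a))`
for all `a ∈ O_F`» (p. 11): exponent `0` at `φ ∈ Φ` and `1` at `φ ∉ Φ` (so that `∏_φ (T − φ(a))^{sig₀ φ} = ∏_{φ ∈ Φ}(T − φ̄(a))`; READING R5).
[cite: RapoportSmithlingZhang2020Diagonal, §3.2 (3.8) p. 11] -/
def sig₀Of (Φ : CMType F) (φ : F →+* ℂ) : ℕ :=
  if φ ∈ Φ.1 then 0 else 1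

end ReflexField

namespace ShimuraDatum

variable {F₀ F}
variable (D : ShimuraDatum F₀ F)

/-- `n = dim_F W` (§2.1 p. 7). [cite: RapoportSmithlingZhang2020Diagonal, §2.1 p. 7] -/
abbrev n : ℕ := D.W.n

/-- `E = E_Φ · φ₀(F)` (Remark 3.1 p. 9) for the datum. [cite: RapoportSmithlingZhang2020Diagonal, §3.1 Remark 3.1 p. 9] -/
abbrev reflexField : IntermediateField ℚ ℂ := reflexFieldOf D.Φ D.φ₀

/-- The signature function of (3.8) for the datum's `Φ`. [cite: RapoportSmithlingZhang2020Diagonal, §3.2 (3.8) p. 11] -/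
abbrev sig₀ : (F →+* ℂ) → ℕ := sig₀Of D.Φ

/-- **(3.14), Remark 3.6 (i)** (p. 13): «`r : Hom(F, ℂ) → {0, 1, n−1, n}`, `φ ↦ r_φ`, … `r_φ := 1, φ = φ₀; 0, φ ∈ Φ ∖ {φ₀}; n − r_φ̄, φ ∉ Φ`»
(`φ̄` = `φ ∘ (a ↦ ā)` = Mathlib `NumberField.ComplexEmbedding.conjugate φ`; for `φ ∉ Φ`, `φ̄ ∈ Φ` so `r_φ̄ ∈ {0, 1}` is given by the first two
clauses).  «Then the Kottwitz condition (3.11) is `char(ι(a) ∣ Lie A) = ∏_{φ ∈ Hom(F,ℂ)} (T − φ(a))^{r_φ}` for all `a ∈ O_F`» (READING R5).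
[cite: RapoportSmithlingZhang2020Diagonal, §3.2 Remark 3.6 (i) (3.14) p. 13] -/
def signatureFn (φ : F →+* ℂ) : ℕ :=
  if φ = D.φ₀ then 1
  else if φ ∈ D.Φ.1 then 0
  else D.n - (if NumberField.ComplexEmbedding.conjugate φ = D.φ₀ then 1 else 0)

/-- **Remark 3.3** (p. 10), the cocharacter at `φ₀`: «in terms of the basis for `W_{φ₀}` chosen above, `h_{G,φ₀}` is the cocharacter
`h_{G,φ₀} : z ↦ diag(z/z̄, 1, …, 1)`» (an `n × n` complex matrix for `z ∈ ℂ^×`; the other components `h_{G,φ}`, `φ ≠ φ₀`, are trivial, p. 10).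
[cite: RapoportSmithlingZhang2020Diagonal, §3.1 Remark 3.3 p. 10] -/
def cocharPhi0 (z : ℂˣ) : Matrix (Fin D.n) (Fin D.n) ℂ :=
  Matrix.diagonal fun i => if i.val = 0 then (z : ℂ) / starRingEnd ℂ (z : ℂ) else 1

/-- **Remark 3.3** (p. 10), `𝒟_{φ₀}`: «the open subset `𝒟_{φ₀} ⊂ ℙ(W_{φ₀})(ℂ)` of positive-definite lines for the hermitian form … (`𝒟_{φ₀}` is
also isomorphic to the open unit ball in `ℂ^{n−1}`)» — typed as the CONE of positive vectors of `W_{φ₀} = W ⊗_{F,φ₀} ℂ ≅ ℂ^n` in the coordinates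
of ★ `HermSpace.basis` (Gram matrix ★ `HermSpace.gram` pushed along `φ₀`; `(x, x)_{φ₀} = x̄ᵀ J^{φ₀} x` as in ★ `DefC1toC3` READING R4), whose
image in `ℙ(ℂ^n)` is `𝒟_{φ₀}`. [cite: RapoportSmithlingZhang2020Diagonal, §3.1 Remark 3.3 p. 10] -/
def posCone : Set (Fin D.n → ℂ) :=
  {x | 0 < (star x ⬝ᵥ (D.W.gram.map D.φ₀) *ᵥ x).re}

end ShimuraDatum

/-! ## `L_Φ^𝔞` (p. 11): hermitian-alternating `O_F`-lattices of rank one (REAL, READING R7) -/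

/-- **An element of `L_Φ^𝔞`** (p. 11): «pairs `(Λ₀, ⟨,⟩₀)` consisting of a locally free `O_F`-module `Λ₀` of rank one equipped with a
non-degenerate alternating form `⟨,⟩₀ : Λ₀ × Λ₀ → ℤ` such that `⟨ax, y⟩₀ = ⟨x, āy⟩₀` for all `x, y ∈ Λ₀` and `a ∈ O_F`, such that
`x ↦ ⟨√Δ x, x⟩₀` is a negative-definite quadratic form on `Λ₀`, and such that the dual lattice `Λ₀^∨` of `Λ₀` inside `Λ₀ ⊗_ℤ ℚ` equals
`𝔞^{-1}Λ₀`», for «a non-zero ideal `𝔞` of `O_{F₀}`».  READING R7: `Λ₀` is realised inside `Λ₀ ⊗ ℚ ≅ F` as a non-zero finitely generated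
`O_F`-submodule `Λ` of `F`, and `⟨,⟩₀` as a `ℚ`-bilinear form on `F` that is `ℤ`-valued on `Λ`; `𝔞^{-1}Λ₀ = {x ∣ 𝔞 x ⊆ Λ₀}`.  Nothing is asserted.
[cite: RapoportSmithlingZhang2020Diagonal, §3.2 p. 11 (with footnote 7)] -/
structure HermLattice (sqrtΔ : F) (𝔞 : Ideal (𝓞 F₀)) : Type where
  /-- `Λ₀ ⊂ Λ₀ ⊗ ℚ = F`, an `O_F`-submodule of `F` (READING R7). -/
  Λ : Submodule (𝓞 F) F
  /-- «locally free of rank one»: finitely generated … -/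
  fg : Λ.FG
  /-- … and non-zero (READING R7). -/
  ne_bot : Λ ≠ ⊥
  /-- «`⟨,⟩₀`», extended `ℚ`-bilinearly to `Λ₀ ⊗ ℚ = F`. -/
  form : F →ₗ[ℚ] F →ₗ[ℚ] ℚ
  /-- «`⟨,⟩₀ : Λ₀ × Λ₀ → ℤ`»: integral on `Λ₀`. -/
  form_integral : ∀ x ∈ Λ, ∀ y ∈ Λ, ∃ m : ℤ, form x y = m
  /-- «alternating». -/
  form_alternating : ∀ x : F, form x x = 0
  /-- «non-degenerate». -/
  form_nondegenerate : ∀ x : F, (∀ y : F, form x y = 0) → x = 0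
  /-- «`⟨ax, y⟩₀ = ⟨x, āy⟩₀` for all `x, y ∈ Λ₀` and `a ∈ O_F`» (stated on `F`, equivalently by bilinearity). -/
  form_smul : ∀ (a : 𝓞 F) (x y : F), form ((a : F) * x) y = form x (conj F₀ F (a : F) * y)
  /-- «`x ↦ ⟨√Δ x, x⟩₀` is a negative-definite quadratic form on `Λ₀`» (equivalently on `Λ₀ ⊗ ℚ = F`). -/
  form_negDef : ∀ x : F, x ≠ 0 → form (sqrtΔ * x) x < 0
  /-- «the dual lattice `Λ₀^∨` of `Λ₀` inside `Λ₀ ⊗ ℚ` equals `𝔞^{-1}Λ₀`»: `x ∈ F` pairs integrally with `Λ₀` iff `𝔞 x ⊆ Λ₀`. -/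
  dual_eq : ∀ x : F, (∀ y ∈ Λ, ∃ m : ℤ, form x y = m) ↔ ∀ a ∈ 𝔞, algebraMap F₀ F (a : F₀) * x ∈ Λ

namespace HermLattice

variable {F₀ F} {sqrtΔ : F} {𝔞 : Ideal (𝓞 F₀)}

/-- Isomorphism of pairs `(Λ₀, ⟨,⟩₀) ≅ (Λ₀', ⟨,⟩₀')` (p. 11: `L_Φ^𝔞` is «the set of isomorphism classes of pairs»): an `O_F`-linear isomorphism
`Λ₀ ≅ Λ₀'` carrying `⟨,⟩₀` to `⟨,⟩₀'` — inside `F` (READING R7) multiplication by some `c ∈ F^×` with `c Λ₀ = Λ₀'`.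
[cite: RapoportSmithlingZhang2020Diagonal, §3.2 p. 11] -/
def IsIsomorphic (L L' : HermLattice F₀ F sqrtΔ 𝔞) : Prop :=
  ∃ c : F, c ≠ 0 ∧ (∀ z : F, z ∈ L'.Λ ↔ ∃ x ∈ L.Λ, z = c * x) ∧ ∀ x y : F, L'.form (c * x) (c * y) = L.form x y

/-- The RATIONAL half of `∼` (p. 12): «`Λ₀ ⊗ ℚ` and `Λ₀' ⊗ ℚ` are `F`-linearly similar up to a factor in `ℚ^×`» (an `F`-linear automorphism of
`Λ₀ ⊗ ℚ = F` is multiplication by some `c ∈ F^×`). [cite: RapoportSmithlingZhang2020Diagonal, §3.2 p. 12] -/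
def RatSimilar (L L' : HermLattice F₀ F sqrtΔ 𝔞) : Prop :=
  ∃ c : F, c ≠ 0 ∧ ∃ q : ℚ, q ≠ 0 ∧ ∀ x y : F, L'.form (c * x) (c * y) = q * L.form x y

end HermLattice

/-! ## §3.2 (p. 11): `M₀`, `M₀^𝔞` — the clause predicates and the REAL objects -/

section Moduli

variable {F₀ F}

/-- The structure map `Spec E → Spec O_E` (REAL; `O_E = 𝓞 E`, `E = reflexFieldOf Φ φ₀`), through which an `E`-scheme is an `O_E`-scheme («We let `M₀`
denote the generic fiber of `M₀`», p. 11). [cite: RapoportSmithlingZhang2020Diagonal, §3.2 p. 11] -/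
def specEToSpecOEOf (Φ : CMType F) (φ₀ : F →+* ℂ) : Spec (.of (reflexFieldOf Φ φ₀)) ⟶ Spec (.of (𝓞 (reflexFieldOf Φ φ₀))) :=
  Spec.map (CommRingCat.ofHom (algebraMap (𝓞 (reflexFieldOf Φ φ₀)) (reflexFieldOf Φ φ₀)))

/-- The structure map `Spec ℂ → Spec O_E` (REAL: `O_E ⊂ E ⊂ ℂ`), for the `ℂ`-points of `M₀^𝔞` (p. 11). [cite: RapoportSmithlingZhang2020Diagonal, §3.2 p. 11] -/
def specCToSpecOEOf (Φ : CMType F) (φ₀ : F →+* ℂ) : Spec (.of ℂ) ⟶ Spec (.of (𝓞 (reflexFieldOf Φ φ₀))) :=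
  Spec.map (CommRingCat.ofHom ((algebraMap (reflexFieldOf Φ φ₀) ℂ).comp (algebraMap (𝓞 (reflexFieldOf Φ φ₀)) (reflexFieldOf Φ φ₀))))

end Moduli

/-- ⟨CARRIER⟩ **The three clauses of the moduli problem `M₀^𝔞` and the pull-back clause of its morphisms** (p. 11), as predicates on the REAL objects (★
`AbelianSchemeOver`, ★ `RingAction (𝓞 F)`, ★ `DualPair` ∕ `Polarization`) that the tree cannot yet evaluate over a general base — each quoting its print;
bundled so that the REAL structure `M0Obj` below can be stated before the full datum.  Nothing is asserted. [cite: RapoportSmithlingZhang2020Diagonal, §3.2 (3.8) p. 11] -/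
structure M0Clauses (Φ : CMType F) (φ₀ : F →+* ℂ) : Type 2 where
  /-- ⟨CARRIER⟩ **the Kottwitz condition of signature `r`** for an abelian scheme `A` over an `O_E`-scheme `f : S → Spec O_E` with `O_F`-action `ι`:
  «`char(ι(a) ∣ Lie A) = ∏_{φ ∈ Hom(F,ℂ)} (T − φ(a))^{r_φ}` for all `a ∈ O_F`» ((3.8) p. 11, (3.11) and Remark 3.6 (i) p. 13; the right-hand side has
  coefficients in `O_E`, compared in `Γ(S, 𝒪_S)[T]` along `f`).  READING R5.  Evaluated by the tree over local affine bases (★ `AbelianScheme.lieCharpoly`). -/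
  IsKottwitz : ∀ {S : Scheme.{0}}, (S ⟶ Spec (.of (𝓞 (reflexFieldOf Φ φ₀)))) →
    ∀ A : AbelianSchemeOver S, A.RingAction (𝓞 F) → ((F →+* ℂ) → ℕ) → Prop
  /-- ⟨CARRIER⟩ «a polarization … whose Rosati involution induces on `O_F`, via `ι`, the nontrivial Galois automorphism of `F/F₀`» (p. 11, p. 13). -/
  RosatiIsConj : ∀ {S : Scheme.{0}} (A : AbelianSchemeOver S) (Dp : A.DualPair), A.Polarization Dp → A.RingAction (𝓞 F) → Prop
  /-- ⟨CARRIER⟩ «`ker λ₀ = A₀[𝔟]`» for an ideal `𝔟` of `O_{F₀}` acting through `ι₀` (p. 11, the variant `M₀^𝔟`). -/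
  KerEqTorsion : ∀ {S : Scheme.{0}} (A : AbelianSchemeOver S) (Dp : A.DualPair), A.Polarization Dp → A.RingAction (𝓞 F) →
    Ideal (𝓞 F₀) → Prop
  /-- ⟨CARRIER⟩ «an isomorphism `μ₀ : A₀ → A₀'` under which `λ₀'` pulls back to `λ₀`» (p. 11): `λ₀ = μ₀^∨ ∘ λ₀' ∘ μ₀`. -/
  PolPullback : ∀ {S : Scheme.{0}} {A A' : AbelianSchemeOver S} {Dp : A.DualPair} {Dp' : A'.DualPair},
    (A.X ≅ A'.X) → A.Polarization Dp → A'.Polarization Dp' → Prop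

/-- **An object of `M₀^𝔟(S)`** for a locally noetherian `O_E`-scheme `f : S → Spec O_E` (p. 11): «triples `(A₀, ι₀, λ₀)`, where `A₀` is an abelian
variety over `S` with an `O_F`-action `ι₀ : O_F → End(A₀)`, which satisfies the Kottwitz condition of signature `((0, 1)_{φ ∈ Φ})`, i.e. (3.8)
`char(ι₀(a) ∣ Lie A₀) = ∏_{φ ∈ Φ} (T − φ̄(a))` for all `a ∈ O_F`; and `λ₀` is a principal polarization of `A₀` whose Rosati involution induces on
`O_F`, via `ι₀`, the nontrivial Galois automorphism of `F/F₀`», in the variant `M₀^𝔟` «except that we replace the condition that `λ₀` is principal by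
the condition that `ker λ₀ = A₀[𝔟]`» (`M₀ = M₀^{(1)}`, READING R6).  REAL `A₀`, `ι₀`, `λ₀`; the clauses through the ⟨CARRIER⟩ predicates `C`.
[cite: RapoportSmithlingZhang2020Diagonal, §3.2 (3.8) p. 11] -/
structure M0Obj {Φ : CMType F} {φ₀ : F →+* ℂ} (C : M0Clauses F₀ F Φ φ₀) (𝔟 : Ideal (𝓞 F₀)) {S : Scheme.{0}}
    (f : S ⟶ Spec (.of (𝓞 (reflexFieldOf Φ φ₀)))) : Type 1 where
  /-- «`A₀` an abelian variety over `S`» (★ `AbelianSchemeOver S`). -/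
  A₀ : AbelianSchemeOver S
  /-- «an `O_F`-action `ι₀ : O_F → End(A₀)`» (★ `RingAction (𝓞 F)`). -/
  ι₀ : A₀.RingAction (𝓞 F)
  /-- the dual pair `(A₀^∨, 𝒫)` carrying the polarization (★ `DualPair`). -/
  D₀ : A₀.DualPair
  /-- «`λ₀` a polarization of `A₀`» (★ `Polarization`); `pol₀` = `λ₀`. -/
  pol₀ : A₀.Polarization D₀
  /-- **(3.8)** «the Kottwitz condition of signature `((0, 1)_{φ ∈ Φ})`» (⟨CARRIER⟩ predicate at the REAL `sig₀Of Φ`). -/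
  kottwitz : C.IsKottwitz f A₀ ι₀ (sig₀Of Φ)
  /-- «whose Rosati involution induces on `O_F`, via `ι₀`, the nontrivial Galois automorphism of `F/F₀`» (⟨CARRIER⟩ predicate). -/
  rosati : C.RosatiIsConj A₀ D₀ pol₀ ι₀
  /-- «`ker λ₀ = A₀[𝔟]`» (⟨CARRIER⟩ predicate; `𝔟 = O_{F₀}`: `λ₀` principal). -/
  ker_eq : C.KerEqTorsion A₀ D₀ pol₀ ι₀ 𝔟

section M0Iso

variable {F₀ F}

/-- **A morphism (isomorphism) in `M₀^𝔟(S)`** (p. 11): «an `O_F`-linear isomorphism `μ₀ : A₀ → A₀'` under which `λ₀'` pulls back to `λ₀`» — REAL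
isomorphism of `S`-schemes commuting with the actions, ⟨CARRIER⟩ pull-back clause. [cite: RapoportSmithlingZhang2020Diagonal, §3.2 p. 11] -/
def M0Obj.Iso {Φ : CMType F} {φ₀ : F →+* ℂ} {C : M0Clauses F₀ F Φ φ₀} {𝔟 : Ideal (𝓞 F₀)} {S : Scheme.{0}}
    {f : S ⟶ Spec (.of (𝓞 (reflexFieldOf Φ φ₀)))} (x y : M0Obj F₀ F C 𝔟 f) : Prop :=
  ∃ e : x.A₀.X ≅ y.A₀.X, (∀ a : 𝓞 F, e.hom ≫ y.ι₀.i a = x.ι₀.i a ≫ e.hom) ∧ C.PolPullback e x.pol₀ y.pol₀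

end M0Iso

/-! ## §3.1–§3.2: the full datum (REAL data above + the ⟨CARRIER⟩ Shimura varieties, labellings and moduli groupoids with their axioms) -/

/-- **The datum of [RSZ2020] §3**, extending `ShimuraDatum` by: the fixed ideal `𝔞` and label `ξ` (p. 12), the ⟨CARRIER⟩ clause predicates `clauses` of
the moduli problems, the ⟨CARRIER⟩ adelic half of `∼` (p. 12), the PARTIAL ⟨CARRIER⟩ Riemann-form map on objects of `M₀^𝔟(ℂ)` and labelling of objects
of `M₀^𝔟` over connected bases (`𝔟 ≠ 0`; p. 11–12, Lemma 3.4), the ⟨CARRIER⟩ canonical models `ShG`, `ShZ`, `ShResG` with the morphisms (3.3), (3.5), the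
⟨CARRIER⟩ objects ∕ isomorphisms ∕ coarse moduli schemes of `M_{K_G̃}(G̃)` with their REAL projections, and — as `Prop` FIELDS, the axioms of the posited
objects (not printed results, no debt) — the consistency of `KerEqTorsion` at `𝔟 = O_{F₀}` with principality, the label `ξ` of the `M₀`-component of an object,
and the coarse-space property on geometric points.  Level subgroups are `K_G ≤ G(𝔸_{F₀,f})` = ★ `HermSpace.Gfin` (READING R3).  A consumer supplies the datum.
[cite: RapoportSmithlingZhang2020Diagonal, §3.1 pp. 8–10 and §3.2 pp. 11–13] -/
structure Sec3Data : Type 2 extends ShimuraDatum F₀ F where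
  /-- «Fix a non-zero ideal `𝔞` of `O_{F₀}`» (p. 11), «we fix an ideal `𝔞` such that `M₀^𝔞` is non-empty» (p. 12). -/
  𝔞 : Ideal (𝓞 F₀)
  /-- «non-zero» (p. 11). -/
  𝔞_ne_bot : 𝔞 ≠ ⊥
  /-- ⟨CARRIER⟩ the clause predicates of `M₀^𝔟` (Kottwitz (3.8)∕(3.11), Rosati, `ker λ₀ = A₀[𝔟]`, pull-back of polarisations; p. 11). -/
  clauses : M0Clauses F₀ F Φ φ₀
  /-- AXIOM of the carrier (READING R6, p. 11: `M₀` has «`λ₀` a principal polarization», `M₀^𝔞` has «`ker λ₀ = A₀[𝔞]`» instead): at `𝔟 = O_{F₀}` the clause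
  `ker λ₀ = A₀[O_{F₀}] (= 0)` says exactly that `λ₀ : A₀ → A₀^∨` is an isomorphism (REAL `IsIso`), so that `M₀ = M₀^{(1)}`. -/
  kerEqTorsion_top : ∀ {S : Scheme.{0}} (A : AbelianSchemeOver S) (Dp : A.DualPair) (pol : A.Polarization Dp) (ι : A.RingAction (𝓞 F)),
    clauses.KerEqTorsion A Dp pol ι ⊤ ↔ IsIso pol.lam
  /-- ⟨CARRIER⟩ the ADELIC half of `∼` (p. 12): «`Λ₀ ⊗ ℤ̂` and `Λ₀' ⊗ ℤ̂` are `Ô_F`-linearly similar up to a factor in `ℤ̂^×`». -/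
  HatSimilar : ∀ {𝔟 : Ideal (𝓞 F₀)}, HermLattice F₀ F sqrtΔ 𝔟 → HermLattice F₀ F sqrtΔ 𝔟 → Prop
  /-- ⟨CARRIER⟩ (PARTIAL: on OBJECTS of `M₀^𝔟(ℂ)`, `𝔟 ≠ 0`) «given a `ℂ`-point `(A₀, ι₀, λ₀)` on `M₀^𝔟`, the first homology group `H₁(A₀(ℂ), ℤ)`, endowed with
  its Riemann form induced by `λ₀`, defines a class in `L_Φ^𝔟`» (p. 11). -/
  riemannLattice : ∀ (𝔟 : Ideal (𝓞 F₀)), 𝔟 ≠ ⊥ → M0Obj F₀ F clauses 𝔟 (specCToSpecOEOf Φ φ₀) → HermLattice F₀ F sqrtΔ 𝔟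
  /-- ⟨CARRIER⟩ (PARTIAL) the labelling of **Lemma 3.4** (3.9) (p. 12): the summand index in `L_Φ^𝔟/∼` of an OBJECT of `M₀^𝔟(S)`, `𝔟 ≠ 0`, over a CONNECTED
  (hence non-empty) `O_E`-scheme `f : S → Spec O_E`. -/
  label : ∀ (𝔟 : Ideal (𝓞 F₀)), 𝔟 ≠ ⊥ → ∀ {S : Scheme.{0}} [ConnectedSpace S] (f : S ⟶ Spec (.of (𝓞 (reflexFieldOf Φ φ₀)))),
    M0Obj F₀ F clauses 𝔟 f → Quot fun L L' : HermLattice F₀ F sqrtΔ 𝔟 => HatSimilar L L' ∧ L.RatSimilar L'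
  /-- «We also fix `ξ ∈ L_Φ^𝔞/∼`» (p. 12). -/
  ξ : Quot fun L L' : HermLattice F₀ F sqrtΔ 𝔞 => HatSimilar L L' ∧ L.RatSimilar L'
  /-- ⟨CARRIER⟩ «canonical models over `E` of the Shimura varieties `Sh_{K_G̃}(G̃, {h_G̃})`» (p. 9), for `K_G̃ = K_{Z^ℚ} × K_G` (READING R3), as a scheme
  over the REAL field `E` (meaningful for `K_G` open compact). -/
  ShG : Subgroup W.Gfin → SchemeOver (reflexFieldOf Φ φ₀)
  /-- ⟨CARRIER⟩ `Sh_{K_{Z^ℚ}}(Z^ℚ, {h_{Z^ℚ}})` over its reflex field «the subfield `E_Φ` of `E`» (Remark 3.2 (i) p. 10), `K_{Z^ℚ}` the group (3.7). -/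
  ShZ : SchemeOver (traceField Φ)
  /-- ⟨CARRIER⟩ `Sh_{K_G}(Res_{F₀/ℚ} G, {h_G})` «considered over its reflex field, which is `F`, embedded into `ℂ` via `φ₀`» (Remark 3.2 (iii) p. 10;
  READING R4: over `F`). -/
  ShResG : Subgroup W.Gfin → SchemeOver F
  /-- ⟨CARRIER⟩ **(3.3)** (Remark 3.2 (i) p. 9): the morphism `Sh_{K_G̃}(G̃) → Sh_{K_{Z^ℚ}}(Z^ℚ)` induced by `G̃ → Z^ℚ` (on total spaces). -/
  prZ : ∀ K : Subgroup W.Gfin, (ShG K).left ⟶ ShZ.left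
  /-- (3.3) lies over `Spec E → Spec E_Φ` (`E_Φ ⊂ E`, Remark 3.2 (i); REAL inclusion). -/
  prZ_comp : ∀ K : Subgroup W.Gfin, prZ K ≫ ShZ.hom =
    (ShG K).hom ≫ Spec.map (CommRingCat.ofHom (IntermediateField.inclusion
      (le_sup_left : traceField Φ ≤ reflexFieldOf Φ φ₀)).toRingHom)
  /-- ⟨CARRIER⟩ **(3.5)** (Remark 3.2 (iii) p. 10): the morphism `Sh_{K_G̃}(G̃) → Sh_{K_G}(Res_{F₀/ℚ} G)` induced by the projection to the second factor
  of (2.1) (on total spaces). -/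
  prG : ∀ K : Subgroup W.Gfin, (ShG K).left ⟶ (ShResG K).left
  /-- (3.5) lies over `Spec E → Spec F`, `F → E` being `φ₀` (Remark 3.1; REAL `phi0ToReflexFieldOf`). -/
  prG_comp : ∀ K : Subgroup W.Gfin, prG K ≫ (ShResG K).hom =
    (ShG K).hom ≫ Spec.map (CommRingCat.ofHom (phi0ToReflexFieldOf Φ φ₀))
  /-- ⟨CARRIER⟩ **the objects of `M_{K_G̃}(G̃)(S)`** for a locally noetherian scheme `f : S → Spec E` (pp. 12–13): «collections
  `(A₀, ι₀, λ₀, A, ι, λ, η̄)`, where `(A₀, ι₀, λ₀)` is an object of `M₀^{𝔞,ξ}(S)`; `A` is an abelian scheme over `S` with an `F`-action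
  `ι : F → End⁰(A)` satisfying the Kottwitz condition of signature `((1, n−1)_{φ₀}, (0, n)_{φ ∈ Φ∖{φ₀}})`, i.e. (3.11)
  `char(ι(a) ∣ Lie A) = (T − φ₀(a))(T − φ̄₀(a))^{n−1} ∏_{φ ∈ Φ∖{φ₀}} (T − φ̄(a))^n` for all `a ∈ O_F`; `λ` is a polarization `A → A^∨` whose Rosati
  involution induces on `F`, via `ι`, the nontrivial Galois automorphism of `F/F₀`; and `η̄` is a `K_G̃`-level structure, by which we mean a `K_G`-orbit
  (equivalently, a `K_G̃`-orbit, where `K_G̃` acts through its projection `K_G̃ → K_G`) of `𝔸_{F,f}`-linear isometries `η : V̂(A₀, A) ≃ −W ⊗_F 𝔸_{F,f}` (3.12)»,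
  `V̂(A₀, A) := Hom_F(V̂(A₀), V̂(A))` with «its natural `𝔸_{F,f}`-valued hermitian form `h_A`, `h_A(x, y) := λ₀^{-1} ∘ y^∨ ∘ λ ∘ x ∈ End_{𝔸_{F,f}}(V̂(A₀)) = 𝔸_{F,f}`
  (3.13)», the orbit required `π₁(S, s̄)`-invariant on each connected component (p. 13).  A TYPE (actions up to isogeny, rational Tate modules of
  abelian schemes and level structures on them have no tree vocabulary); its REAL shadows are the projections `objA`, `objM0` below. -/
  Obj : Subgroup W.Gfin → ∀ {S : Scheme.{0}}, (S ⟶ Spec (.of (reflexFieldOf Φ φ₀))) → Type 1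
  /-- ⟨CARRIER⟩ **the morphisms of `M_{K_G̃}(G̃)(S)`** (p. 13), as the relation «isomorphic»: «an isomorphism `μ₀ : (A₀, ι₀, λ₀) ≅ (A₀', ι₀', λ₀')` in
  `M₀^{𝔞,ξ}(S)` and an `F`-linear quasi-isogeny `μ : A → A'` pulling `λ'` back to `λ` and `η̄'` back to `η̄`». -/
  ObjIso : ∀ {K : Subgroup W.Gfin} {S : Scheme.{0}} {f : S ⟶ Spec (.of (reflexFieldOf Φ φ₀))}, Obj K f → Obj K f → Prop
  /-- REAL projection: the abelian scheme `A` over `S` of an object (p. 13). -/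
  objA : ∀ {K : Subgroup W.Gfin} {S : Scheme.{0}} {f : S ⟶ Spec (.of (reflexFieldOf Φ φ₀))}, Obj K f → AbelianSchemeOver S
  /-- REAL projection: the component «`(A₀, ι₀, λ₀)` is an object of `M₀^{𝔞,ξ}(S)`» (p. 12, first bullet) — an object of `M₀^𝔞` over `S → Spec E → Spec O_E`
  (its printed clauses are the fields of ★ `M0Obj`). -/
  objM0 : ∀ {K : Subgroup W.Gfin} {S : Scheme.{0}} {f : S ⟶ Spec (.of (reflexFieldOf Φ φ₀))},
    Obj K f → M0Obj F₀ F clauses 𝔞 (f ≫ specEToSpecOEOf Φ φ₀)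
  /-- AXIOM of the carrier (p. 12, first bullet: the component lies in the summand `M₀^{𝔞,ξ}`): over a connected base its label is `ξ`. -/
  objM0_label : ∀ {K : Subgroup W.Gfin} {S : Scheme.{0}} [ConnectedSpace S] {f : S ⟶ Spec (.of (reflexFieldOf Φ φ₀))} (x : Obj K f),
    label 𝔞 𝔞_ne_bot (f ≫ specEToSpecOEOf Φ φ₀) (objM0 x) = ξ
  /-- ⟨CARRIER⟩ **the coarse moduli scheme of `M_{K_G̃}(G̃)`** (Proposition 3.7 p. 13), a scheme over `E` (meaningful for `K_G` open compact). -/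
  coarse : Subgroup W.Gfin → SchemeOver (reflexFieldOf Φ φ₀)
  /-- ⟨CARRIER⟩ the classifying map of the coarse moduli scheme on geometric points: an object over an algebraically closed field `Ω ⊇ E` ↦ its
  `Ω`-point of `coarse K` (Proposition 3.7). -/
  coarsePt : ∀ (K : Subgroup W.Gfin) (Ω : Type) [Field Ω] [Algebra (reflexFieldOf Φ φ₀) Ω], IsAlgClosed Ω →
    Obj K (Spec.map (CommRingCat.ofHom (algebraMap (reflexFieldOf Φ φ₀) Ω))) → AlgPoints (coarse K) Ω
  /-- AXIOM of the carrier (the meaning of «coarse moduli scheme» on points, Proposition 3.7): for `K_G` open compact and `Ω ⊇ E` algebraically closed,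
  `coarsePt` induces a bijection `M_{K_G̃}(G̃)(Ω)/≅ → (coarse K)(Ω)`. -/
  coarsePt_bijective : ∀ (K : Subgroup W.Gfin), IsOpen (K : Set W.Gfin) ∧ IsCompact (K : Set W.Gfin) →
    ∀ (Ω : Type) [Field Ω] [Algebra (reflexFieldOf Φ φ₀) Ω] (hΩ : IsAlgClosed Ω),
      Function.Surjective (coarsePt K Ω hΩ) ∧ ∀ x y, coarsePt K Ω hΩ x = coarsePt K Ω hΩ y ↔ ObjIso x y

namespace Sec3Data

variable {F₀ F}
variable (D : Sec3Data F₀ F)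

/-- `E = E_Φ · φ₀(F)`, the reflex field (Remark 3.1). [cite: RapoportSmithlingZhang2020Diagonal, §3.1 Remark 3.1 p. 9] -/
abbrev E : IntermediateField ℚ ℂ := D.toShimuraDatum.reflexField

/-- `L_Φ^𝔟/∼` (p. 12): the quotient of `L_Φ^𝔟` by `∼` = (⟨CARRIER⟩ adelic similarity) ∧ (REAL rational similarity).
[cite: RapoportSmithlingZhang2020Diagonal, §3.2 p. 12] -/
abbrev LabelSet (𝔟 : Ideal (𝓞 F₀)) : Type :=
  Quot fun L L' : HermLattice F₀ F D.sqrtΔ 𝔟 => D.HatSimilar L L' ∧ L.RatSimilar L'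

/-- The objects of `M₀^𝔟(S)` for the datum (`M0Obj` at the datum's clause predicates). [cite: RapoportSmithlingZhang2020Diagonal, §3.2 p. 11] -/
abbrev M0 (𝔟 : Ideal (𝓞 F₀)) {S : Scheme.{0}} (f : S ⟶ Spec (.of (𝓞 D.E))) : Type 1 := M0Obj F₀ F D.clauses 𝔟 f

/-- «`K_G ⊂ G(𝔸_{F₀,f})` is an open compact subgroup» ((3.6) p. 11). [cite: RapoportSmithlingZhang2020Diagonal, §3.2 (3.6) p. 11] -/
def IsLevel (K : Subgroup D.W.Gfin) : Prop :=
  IsOpen (K : Set D.W.Gfin) ∧ IsCompact (K : Set D.W.Gfin)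

/-- The structure map `Spec E → Spec O_E` for the datum. [cite: RapoportSmithlingZhang2020Diagonal, §3.2 p. 11] -/
abbrev specEToSpecOE : Spec (.of D.E) ⟶ Spec (.of (𝓞 D.E)) := specEToSpecOEOf D.Φ D.φ₀

/-- The structure map `Spec ℂ → Spec O_E` for the datum. [cite: RapoportSmithlingZhang2020Diagonal, §3.2 p. 11] -/
abbrev specCToSpecOE : Spec (.of ℂ) ⟶ Spec (.of (𝓞 D.E)) := specCToSpecOEOf D.Φ D.φ₀

/-! ### `L_Φ^𝔞` is finite, and classifies `M₀^𝔞(ℂ)` (p. 11) -/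

/-- **«Then `L_Φ^𝔞` is a finite set»** (p. 11; footnote 7: finiteness of the class group of `F` and the product formula for hermitian spaces): finitely
many isomorphism classes of pairs `(Λ₀, ⟨,⟩₀)`, for every non-zero `𝔟`. [cite: RapoportSmithlingZhang2020Diagonal, §3.2 p. 11 (footnote 7)] -/
def LPhi_finite : Prop :=
  ∀ 𝔟 : Ideal (𝓞 F₀), 𝔟 ≠ ⊥ →
    ∃ T : Finset (HermLattice F₀ F D.sqrtΔ 𝔟), ∀ L : HermLattice F₀ F D.sqrtΔ 𝔟, ∃ L' ∈ T, L.IsIsomorphic L'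

/-- **«In this way `L_Φ^𝔞` is in bijection with the isomorphism classes of objects in `M₀^𝔞(ℂ)`»** (p. 11), the map being «`H₁(A₀(ℂ), ℤ)`, endowed with
its Riemann form induced by `λ₀`» (⟨CARRIER⟩ `riemannLattice`) and its inverse «`(Λ₀ ⊗_ℤ ℝ)/Λ₀` is a complex torus which defines a `ℂ`-point on
`M₀^𝔞`»: `riemannLattice 𝔟` is injective and surjective on isomorphism classes, for every non-zero `𝔟`. [cite: RapoportSmithlingZhang2020Diagonal, §3.2 p. 11] -/
def LPhi_bijective : Prop :=
  ∀ (𝔟 : Ideal (𝓞 F₀)) (h𝔟 : 𝔟 ≠ ⊥),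
    (∀ x y : D.M0 𝔟 D.specCToSpecOE, (D.riemannLattice 𝔟 h𝔟 x).IsIsomorphic (D.riemannLattice 𝔟 h𝔟 y) ↔ x.Iso y) ∧
    (∀ L : HermLattice F₀ F D.sqrtΔ 𝔟, ∃ x : D.M0 𝔟 D.specCToSpecOE, (D.riemannLattice 𝔟 h𝔟 x).IsIsomorphic L)

/-! ### Lemma 3.4 and its sequel (p. 12) -/

/-- **[RSZ2020, Lemma 3.4]** (p. 12): «The stack `M₀^𝔞` admits a decomposition into open and closed substacks `M₀^𝔞 = ∐_{ξ ∈ L_Φ^𝔞/∼} M₀^{𝔞,ξ}` (3.9)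
induced by sending an object `(A₀, ι₀, λ₀)` in `M₀^𝔞(ℂ)` to the `∼`-class of `H₁(A₀(ℂ), ℤ)` endowed with its Riemann form» (and (3.10), the same for
the generic fibre `M₀^𝔞`).  Typed on the ⟨CARRIER⟩ labelling `label 𝔟 _ f : M₀^𝔟(S) → L_Φ^𝔟/∼`, `S` connected, `𝔟 ≠ 0` (READING R8): it is (a) invariant
under isomorphisms in `M₀^𝔟(S)`, (b) equal to the label of the base change of the object along every field-valued point `s : Spec k → S` (REAL ★
`baseChange` of abelian schemes ∕ actions ∕ dual pairs ∕ polarisations; the clauses are transported by the datum's axiom-free reading: the base change is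
again labelled AS A TRIPLE only through an object, so (b) quantifies over objects `y` over `Spec k` whose REAL components ARE the base change) —
«open and closed»: a connected base maps into one summand —, and (c) at `S = Spec ℂ` it is the `∼`-class of the Riemann lattice («induced by»).
[cite: RapoportSmithlingZhang2020Diagonal, §3.2 Lemma 3.4 (3.9)–(3.10) p. 12] -/
def Lemma34 : Prop :=
  ∀ (𝔟 : Ideal (𝓞 F₀)) (h𝔟 : 𝔟 ≠ ⊥),
    -- (a) isomorphism invariance
    (∀ {S : Scheme.{0}} [IsLocallyNoetherian S] [ConnectedSpace S] (f : S ⟶ Spec (.of (𝓞 D.E))) (x y : D.M0 𝔟 f),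
        x.Iso y → D.label 𝔟 h𝔟 f x = D.label 𝔟 h𝔟 f y) ∧
    -- (b) «open and closed»: over a connected base the label of an object is the label of each of its field-valued points
    (∀ {S : Scheme.{0}} [IsLocallyNoetherian S] [ConnectedSpace S] (f : S ⟶ Spec (.of (𝓞 D.E))) (x : D.M0 𝔟 f)
        (k : Type) [Field k] (s : Spec (.of k) ⟶ S) (y : D.M0 𝔟 (s ≫ f)),
        y.A₀ = x.A₀.baseChange s → y.ι₀ ≍ x.ι₀.baseChange s → y.D₀ ≍ x.D₀.baseChange s → y.pol₀ ≍ x.pol₀.baseChange s →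
          D.label 𝔟 h𝔟 (s ≫ f) y = D.label 𝔟 h𝔟 f x) ∧
    -- (c) «induced by sending an object in `M₀^𝔞(ℂ)` to the `∼`-class of `H₁(A₀(ℂ), ℤ)` with its Riemann form»
    (∀ x : D.M0 𝔟 D.specCToSpecOE, D.label 𝔟 h𝔟 D.specCToSpecOE x = Quot.mk _ (D.riemannLattice 𝔟 h𝔟 x))

/-- **Sequel of Lemma 3.4** (p. 12): «If `M₀^𝔞 ≠ ∅`, then for fixed `ξ ∈ L_Φ^𝔞/∼`, the complex fiber `M₀^{𝔞,ξ} ⊗_{O_E} ℂ` of the summand in (3.9) is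
canonically isomorphic to the Shimura variety `Sh_{K_{Z^ℚ}}(Z^ℚ, {h_{Z^ℚ}})`» — ON COMPLEX POINTS (a deliberate weakening: the print asserts an isomorphism of
`ℂ`-schemes; `M₀` being zero-dimensional étale, its `ℂ`-points modulo isomorphism are what the carrier sees): the isomorphism classes of objects of
`M₀^{𝔞,ξ}(ℂ)` are in bijection with the `ℂ`-points of the ⟨CARRIER⟩ `ShZ` (a scheme over `E_Φ ⊂ ℂ`), for the datum's fixed `𝔞`, `ξ`.
[cite: RapoportSmithlingZhang2020Diagonal, §3.2 p. 12 (after Lemma 3.4)] -/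
def Lemma34_complexFibre : Prop :=
  Nonempty (D.M0 D.𝔞 D.specCToSpecOE) →
    ∃ c : {x : D.M0 D.𝔞 D.specCToSpecOE // D.label D.𝔞 D.𝔞_ne_bot D.specCToSpecOE x = D.ξ} → AlgPoints D.ShZ ℂ,
      Function.Surjective c ∧ ∀ x y, c x = c y ↔ x.1.Iso y.1

/-! ### Remark 3.5 (p. 12) -/

/-- **[RSZ2020, Remark 3.5 (i)]** (p. 12): «Given finitely many prime numbers `p₁, …, p_r`, there always exists an ideal `𝔞` relatively prime to
`p₁, …, p_r` such that `M₀^𝔞` is non-empty» («non-empty» = has an object over `Spec ℂ`, equivalent for a stack finite étale over `O_E`, p. 11; «relatively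
prime to `p_i`» = `𝔞 + (p_i) = O_{F₀}`). [cite: RapoportSmithlingZhang2020Diagonal, §3.2 Remark 3.5 (i) p. 12] -/
def Rem35_i : Prop :=
  ∀ P : Finset ℕ, (∀ p ∈ P, p.Prime) →
    ∃ 𝔟 : Ideal (𝓞 F₀), 𝔟 ≠ ⊥ ∧ (∀ p ∈ P, 𝔟 ⊔ Ideal.span {(p : 𝓞 F₀)} = ⊤) ∧ Nonempty (D.M0 𝔟 D.specCToSpecOE)

/-- **[RSZ2020, Remark 3.5 (ii)]** (p. 12): «If `F/F₀` is ramified at some finite place, then `M₀^𝔞` is non-empty for any `𝔞`, cf. [Howard2012, proof of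
Prop. 3.1.6].» (ramified at some finite place: some non-zero prime `w` of `O_F` has ramification index `e(w | w ∩ O_{F₀}) > 1`, Mathlib `Ideal.ramificationIdx`;
«any `𝔞`» = any non-zero ideal, p. 11.) [cite: RapoportSmithlingZhang2020Diagonal, §3.2 Remark 3.5 (ii) p. 12] -/
def Rem35_ii : Prop :=
  (∃ w : IsDedekindDomain.HeightOneSpectrum (𝓞 F), 1 < w.asIdeal.ramificationIdx (𝓞 F₀)) →
    ∀ 𝔟 : Ideal (𝓞 F₀), 𝔟 ≠ ⊥ → Nonempty (D.M0 𝔟 D.specCToSpecOE)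

/-- **[RSZ2020, Remark 3.5 (iii)]** (p. 12): «When `F₀ = ℚ`, the set `L_Φ^𝔞/∼` is a singleton, so that the decomposition (3.9) is trivial.»
(`F₀ = ℚ` = `[F₀ : ℚ] = 1`; «singleton» = non-empty with exactly one class; `𝔞` non-zero, p. 11.) [cite: RapoportSmithlingZhang2020Diagonal, §3.2 Remark 3.5 (iii) p. 12] -/
def Rem35_iii : Prop :=
  Module.finrank ℚ F₀ = 1 → ∀ 𝔟 : Ideal (𝓞 F₀), 𝔟 ≠ ⊥ → Nonempty (D.LabelSet 𝔟) ∧ Subsingleton (D.LabelSet 𝔟)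

/-! ### Proposition 3.7 (p. 13), Remark 3.1 (Harris–Taylor case, p. 9) and Remark 3.8 (p. 15) -/

/-- **[RSZ2020, Proposition 3.7]** (p. 13): «`M_{K_G̃}(G̃)` is a Deligne–Mumford stack smooth of relative dimension `n − 1` over `Spec E`. The coarse
moduli scheme of `M_{K_G̃}(G̃)` is a quasi-projective scheme over `Spec E`, naturally isomorphic to the canonical model of `Sh_{K_G̃}(G̃, {h_G̃})`. For
`K_G̃` sufficiently small, the forgetful morphism `M_{K_G̃}(G̃) → M₀^{𝔞,ξ}` is relatively representable.» («a special case of Deligne's description of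
Shimura varieties of PEL type», p. 13.)  TYPED: the second sentence, for every open compact `K_G` (READING R3) — the ⟨CARRIER⟩ coarse moduli scheme
(whose classifying map on geometric points is bijective on isomorphism classes by the datum's axiom `coarsePt_bijective`) is quasi-projective over `E` (★
`Liu2021.AppendixC.IsQuasiProjectiveOver`) and isomorphic over `E` to the ⟨CARRIER⟩ canonical model `ShG K`.  The first sentence (smoothness of relative
dimension `n − 1` of the STACK) and the third (relative representability) are printed claims RECORDED here, not typed (no DM-stack vocabulary).
[cite: RapoportSmithlingZhang2020Diagonal, §3.2 Proposition 3.7 p. 13] -/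
def Prop37 : Prop :=
  ∀ K : Subgroup D.W.Gfin, D.IsLevel K → IsQuasiProjectiveOver (D.coarse K) ∧ Nonempty (D.coarse K ≅ D.ShG K)

/-- **[RSZ2020, Remark 3.1, first sentence]** (p. 9): «When `F` is of the form `K F₀` for an imaginary quadratic field `K/ℚ` and `Φ` is the unique CM
type induced from `K` containing `φ₀` (the case taken by Harris–Taylor), `φ₀` identifies `F ≅ E`.» — `K ⊆ F` with `[K : ℚ] = 2`, `K · F₀ = F`,
`Φ = {φ ∣ φ|_K = φ₀|_K}`; conclusion `E = φ₀(F)`. (The general case «`E` is the join of `F` and `E_Φ`» is the definition `reflexFieldOf`.)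
[cite: RapoportSmithlingZhang2020Diagonal, §3.1 Remark 3.1 p. 9] -/
def Rem31_harrisTaylor : Prop :=
  ∀ K : IntermediateField ℚ F, Module.finrank ℚ K = 2 →
    K ⊔ (IsScalarTower.toAlgHom ℚ F₀ F).fieldRange = ⊤ →
    (∀ φ : F →+* ℂ, φ ∈ D.Φ.1 ↔ ∀ x : K, φ (x : F) = D.φ₀ (x : F)) →
      D.E = D.φ₀.toRatAlgHom.fieldRange

/-- **[RSZ2020, Remark 3.8, first sentence]** (p. 15): «For `F₀ ≠ ℚ`, the Shimura varieties above are compact.» — typed for the canonical models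
`Sh_{K_G̃}(G̃)` of the datum (⟨CARRIER⟩ `ShG K`, `K_G` open compact): proper over `E`.  (Second half, recorded: «For `F₀ = ℚ`, it may happen that the
Shimura variety `M_{K_{H̃G}}(H̃G)` is non-compact. In fact, this will be automatic when `n ≥ 3`. In this case, we will need to use its canonical
toroidal compactification.») [cite: RapoportSmithlingZhang2020Diagonal, §3.2 Remark 3.8 p. 15] -/
def Rem38 : Prop :=
  1 < Module.finrank ℚ F₀ → ∀ K : Subgroup D.W.Gfin, D.IsLevel K → IsProper (D.ShG K).hom

end Sec3Data

end Literature.AlgebraicGeometry.ShimuraVarieties.RapoportSmithlingZhang2020.Sec3IntegralModels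

end
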